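import Summits.QuantumFields.YangMills.Theorems.BalabanUVNodesN15KingModelCoverTopPiece
import Summits.QuantumFields.YangMills.Theorems.BalabanUVNodesN15KingModelCoverNE2Unit
import HarnessLib

/-!
# BalabanUVNodes ∕ N15 — THE KING-MODEL RUNG (PART Ͻ-o): FINITE COVERS — THE TWO-SPACING RATE OF KING's TOP-SCALE PIECE `G^η_{(K)}` AT EVERY TORON: the g0 rung's uniform
# estimate `|G_{(K+1)}(L^{K+1}b, L^{K+1}b′) − G_{(K)}(L^Kb, L^Kb′)| ≤ C·e^{−δ|b−b′|}·(L^{−γ∕2})^K` («Proposition 3.9 holds for G^η_{(K)}», King p.675) holds AT EVERY CONSTANT ABELIAN LINK FIELD with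
# `C ↦ C·K_{d+1}(δ∕2)`, `δ ↦ δ∕2` — covers `2L^{m+i}` of King's volume `2L^m`, trivial holonomy on the cover, periodisation, continuity, density
# (Track A, DAG node N15 = NE2; FAN-OUT v1.1 §N15 s3 «KING-MODEL RUNG … NE2's analogue DECIDED in the model … + what the curved case adds»; count-neutral)

HONEST FRAMING.  Count-neutral (cell `pub-ymgap`, seat `pub-ymgap-dag-n15-e` g45; `--supports stmt-QuantumFields-27247 --as helper` = K3ᴬ, KEY MAP v3).  King's `A = 0`
comparison model [King1986]: the FINE (site) layer object of the g0 rung (top-scale piece at block base points, `topPieceStep`, King-volume family `2L^m`, odd `L ≥ 3`) at a toron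
(PART Ͷ-k letters); constants = the g0 rung's `(C, δ)` of `topPiece_step_le` (King's Prop 3.8∕3.9 constants of the tree) × the lattice constant.  NOT Bałaban's `G_k(U)` ∕ Thm 3.2 (3.48)
at curved non-abelian backgrounds; NOT a node discharge (N15 of record untouched); nothing continuum ∕ ℝ⁴ ∕ OS ∕ Clay.

PROVED HERE:
* §1 `coverIdx` (def: the index `(m+i, K, Msz)`), `kingVol_dvd_coverIdx`, `toronTopPieceStep` (def: `topPieceTwBase_{K+1}(ω) − topPieceTwBase_K(ω^L)` on King's volume — the toron twin of g0's
  `topPieceStep`), ★★ `norm_toronTopPieceStep_eq_abs_topPieceStep` (trivial holonomy ⇒ EXACTLY `|topPieceStep|`), ★★ `norm_toronTopPieceStep_le_cover` (g0's `topPiece_step_le` VERBATIM at the toron);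
* §2 ★★★ **`norm_toronTopPieceStep_le_closed`** (finite-order holonomy on `2L^m` via the cover `2L^{m+i}`: `≤ C·K_{d+1}(δ∕2)·e^{−(δ∕2)d(b₀,b)}·θ^K`, uniform in `i`);
* §3 `tendsto_rootAngle_of_le`∕`tendsto_rootApprox_of_le` (any `P_i ≥ i+1`), `succ_le_mul_pow`, `approxTop` (def) + `approxTop_pow_period`∕`tendsto_approxTop`, ★ `continuousAt_topPieceTwBase_apply`,
  ★ `continuousAt_toronTopPieceStep`, ★★★★ **`norm_toronTopPieceStep_le_all`** (`∃ C δ > 0` — functions of `d, L, a, m², γ` only — with `‖toronTopPieceStep j ω b₀ b‖ ≤ C·e^{−δd(b₀,b)}·(L^{−γ∕2})^K`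
  for EVERY index and EVERY unit phase vector `ω`).
PRIOR TREE ART (by name): Ͻ-n (`topPieceTwBase`, `topPieceTwBase_apply`, `norm_topPieceTwBase_sub_eq`, `norm_topPieceTwBase_sub_apply_le_of_cover`, `topPieceTw`), Ͻ-j (`rootAngle`, `rootApprox`,
`rootApprox_pow_eq_one`, `abs_rootAngle_sub_le`, `exp_arg_mul_I_of_norm_eq_one`), Ͻ-h′ (`sum_fiber_exp_le`), Ͻ-d (`exists_char_of_pow_eq_one`, `norm_eq_one_of_pow_period`), Ͻ-i
(`continuousAt_toronOp_inv`, `continuousAt_fineOpTw_inv`), Ͻ-k (`toronBg`), the g0 rung (`KingVolIndex`, `kingVol`, `kingVol_neZero`, `topPieceStep`, `topPieceBase`, `topPiece_step_le`),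
`King1986.aK_pos`, `King1986.Torus.tdistT`, `B4Sect5Proof.latticeConst`∕`latticeConst_nonneg`.  Dedup (rg at filing): basename 0 files; needles `toronTopPieceStep|coverIdx|approxTop|
norm_toronTopPieceStep` 0 tree files.  presearch: n/a (composition).  Locators: [King1986] Prop. 3.9 (3.73) p.665, p.675 («Proposition 3.9 holds for G^η_{(K)}»), (4.44)–(4.45) p.675, (2.17)
p.653; [Balaban1985BackgroundPropagators] Thm 3.2 (3.48) p.398 (the site-layer shape), p.398 l.19.  0 `sorry`, 3 `def`.
-/

noncomputable section

open scoped BigOperators ComplexConjugate ComplexOrder Topology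
open Finset Matrix Filter Complex

namespace Summit.QuantumFields.YangMills.BalabanUVNodes.N15KingModelRung.Cover

open Literature.MathematicalPhysics.QuantumFieldTheory.Balaban1983to89.B5Prop11Plancherel (Tor unitVec fine chi)
open Literature.MathematicalPhysics.QuantumFieldTheory.Balaban1983to89.B4Sect5Proof (latticeConst latticeConst_nonneg)
open Literature.MathematicalPhysics.QuantumFieldTheory.King1986 (aK aK_pos)
open Literature.MathematicalPhysics.QuantumFieldTheory.King1986.Torus (tdistT)
open Summit.QuantumFields.YangMills.BalabanUVNodes.N15KingModelRung (KingVolIndex kingVol kingVol_neZero topPieceStep topPieceBase topPiece_step_le basePt)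
open Summit.QuantumFields.YangMills.BalabanUVNodes.N15KingModelRung.Toron (toronOp fineOpTw)

variable {d : ℕ} (L : ℕ) [NeZero L]

/-! ## §1 The toron top-piece step on King's volumes; covers `2L^{m+i}` -/

/-- THE COVER INDEX: volume exponent `m + i`, same level `K` and size letter. [folklore] -/
def coverIdx (j : KingVolIndex d) (i : ℕ) : KingVolIndex d := ⟨j.m + i, j.K, j.one_le_K, j.Msz, j.one_le_Msz⟩

omit [NeZero L] in
/-- King's volume `2L^m` divides the cover's `2L^{m+i}` in every direction. [folklore] -/
theorem kingVol_dvd_coverIdx (j : KingVolIndex d) (i : ℕ) : ∀ μ, kingVol L j μ ∣ kingVol L (coverIdx j i) μ :=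
  fun _ => mul_dvd_mul_left 2 (pow_dvd_pow L (Nat.le_add_right _ _))

/-- THE TORON TOP-PIECE STEP on King's volume of index `j`: level `K+1` at the finer phases `ω` minus level `K` at the coarser phases `ω^L`, at block base points — the toron twin of the
g0 rung's `topPieceStep`. [cite: King1986, Prop. 3.9 (3.73) p.665, (4.44)–(4.45) p.675] -/
def toronTopPieceStep (a m2 : ℝ) (j : KingVolIndex d) (ω : Fin (d + 1) → ℂ) (b b' : Tor (kingVol L j)) : ℂ :=
  haveI := kingVol_neZero L j
  topPieceTwBase (L ^ 1 * L ^ j.K) (kingVol L j) L a m2 (j.K + 1) ω b b' - topPieceTwBase (L ^ j.K) (kingVol L j) L a m2 j.K (fun μ => ω μ ^ (L ^ 1)) b b'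

/-- ★★ **TRIVIAL HOLONOMY ⇒ EXACTLY THE g0 RUNG's MODULUS**: if `ω_μ^{L·L^K·(2L^m)} = 1` for all `μ` then `‖toronTopPieceStep j ω b b′‖ = |topPieceStep j b b′|` (`a > 0`, `L ≥ 2`).
[cite: King1986, (4.45) p.675, Prop. 3.9 (3.73) p.665] -/
theorem norm_toronTopPieceStep_eq_abs_topPieceStep (hL : 2 ≤ L) {a : ℝ} (ha : 0 < a) {m2 : ℝ} (hm : 0 < m2) (j : KingVolIndex d) {ω : Fin (d + 1) → ℂ}
    (hω : ∀ μ, ω μ ^ fine (L ^ 1 * L ^ j.K) (kingVol L j) μ = 1) (b b' : Tor (kingVol L j)) :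
    ‖toronTopPieceStep L a m2 j ω b b'‖ = |topPieceStep L a m2 j b b'| := by
  haveI := kingVol_neZero L j
  have hL1 : (1 : ℝ) < L := by exact_mod_cast hL
  have hω₁ : ∀ μ, (fun μ => ω μ ^ (L ^ 1)) μ ^ fine (L ^ j.K) (kingVol L j) μ = 1 := fun μ => by
    have h1 : L ^ 1 * fine (L ^ j.K) (kingVol L j) μ = fine (L ^ 1 * L ^ j.K) (kingVol L j) μ := by simp only [fine]; ring
    simp only [← pow_mul, h1, hω]
  obtain ⟨p₂, hp₂⟩ := exists_char_of_pow_eq_one (fine (L ^ 1 * L ^ j.K) (kingVol L j)) hω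
  obtain ⟨p₁, hp₁⟩ := exists_char_of_pow_eq_one (fine (L ^ j.K) (kingVol L j)) hω₁
  have hθ : ∀ μ, chi (fine (L ^ j.K) (kingVol L j)) p₁ (unitVec _ μ) ^ (L ^ j.K) = chi (fine (L ^ 1 * L ^ j.K) (kingVol L j)) p₂ (unitVec _ μ) ^ (L ^ 1 * L ^ j.K) := fun μ => by
    rw [hp₁, hp₂, ← pow_mul, mul_comm]
  unfold toronTopPieceStep topPieceStep
  exact norm_topPieceTwBase_sub_eq (kingVol L j) (L ^ j.K) (L ^ 1 * L ^ j.K) L j.K (j.K + 1) (aK_pos ha hL1 j.one_le_K).le (aK_pos ha hL1 (by omega)).le hm hp₁ hp₂ hθ b b'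

/-! ## §2 Finite-order holonomy on `2L^m`: the g0 bound periodised over the cover `2L^{m+i}` -/

/-- ★★★ **THE TOP-PIECE STEP AT A TORON OF FINITE-ORDER HOLONOMY, CLOSED FORM**: given the g0 rung's uniform bound `|topPieceStep j′ b̃ b̃′| ≤ C·e^{−δd}·θ^{K}` on ALL indices, for phases `ω`
with trivial holonomy on the cover `2L^{m+i}` (`ω_μ^{L^{K+1}·2L^{m+i}} = 1`): `‖toronTopPieceStep j ω (π b̃) b‖ ≤ C·K_{d+1}(δ∕2)·e^{−(δ∕2)·d(π b̃, b)}·θ^K` — INDEPENDENT of `i`.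
[cite: King1986, Prop. 3.9 (3.73) p.665, p.675] -/
theorem norm_toronTopPieceStep_le_closed (hL : 2 ≤ L) {a : ℝ} (ha : 0 < a) {m2 : ℝ} (hm : 0 < m2) {C δ θ : ℝ} (hC : 0 ≤ C) (hδ : 0 < δ) (hθ : 0 ≤ θ)
    (H : ∀ (j' : KingVolIndex d) (b b' : Tor (kingVol L j')), haveI := kingVol_neZero L j'; |topPieceStep L a m2 j' b b'| ≤ C * Real.exp (-(δ * tdistT (kingVol L j') b b')) * θ ^ j'.K)
    (j : KingVolIndex d) (i : ℕ) {ω : Fin (d + 1) → ℂ} (hω : ∀ μ, ω μ ^ fine (L ^ 1 * L ^ j.K) (kingVol L (coverIdx j i)) μ = 1)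
    (b' : Tor (kingVol L (coverIdx j i))) (b : Tor (kingVol L j)) :
    haveI := kingVol_neZero L j; haveI := kingVol_neZero L (coverIdx j i)
    ‖toronTopPieceStep L a m2 j ω (proj (kingVol_dvd_coverIdx L j i) b') b‖
      ≤ C * (latticeConst (d + 1) (δ / 2) * Real.exp (-(δ / 2 * tdistT (kingVol L j) (proj (kingVol_dvd_coverIdx L j i) b') b))) * θ ^ j.K := by
  haveI := kingVol_neZero L j; haveI := kingVol_neZero L (coverIdx j i)
  have hL1 : (1 : ℝ) < L := by exact_mod_cast hL
  have hωu : ∀ μ, ‖ω μ‖ = 1 := norm_eq_one_of_pow_period (fine (L ^ 1 * L ^ j.K) (kingVol L (coverIdx j i))) hω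
  have hω₁u : ∀ μ, ‖(fun μ => ω μ ^ (L ^ 1)) μ‖ = 1 := fun μ => by simp [norm_pow, hωu μ]
  have hcov : ∀ (c c' : Tor (kingVol L (coverIdx j i))), ‖topPieceTwBase (L ^ 1 * L ^ j.K) (kingVol L (coverIdx j i)) L a m2 (j.K + 1) ω c c'
      - topPieceTwBase (L ^ j.K) (kingVol L (coverIdx j i)) L a m2 j.K (fun μ => ω μ ^ (L ^ 1)) c c'‖ ≤ C * Real.exp (-(δ * tdistT (kingVol L (coverIdx j i)) c c')) * θ ^ j.K := by
    intro c c'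
    have h1 := norm_toronTopPieceStep_eq_abs_topPieceStep L hL ha hm (coverIdx j i) hω c c'
    calc _ = |topPieceStep L a m2 (coverIdx j i) c c'| := h1
      _ ≤ _ := H (coverIdx j i) c c'
  have hmain := norm_topPieceTwBase_sub_apply_le_of_cover (L ^ j.K) (L ^ 1 * L ^ j.K) (kingVol_dvd_coverIdx L j i) L j.K (j.K + 1)
    (aK_pos ha hL1 j.one_le_K).le (aK_pos ha hL1 (by omega)).le hm hω₁u hωu hcov b' b
  unfold toronTopPieceStep
  refine hmain.trans ?_
  have hs := sum_fiber_exp_le (kingVol_dvd_coverIdx L j i) hδ b' b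
  calc ∑ b'' ∈ fiber (proj (kingVol_dvd_coverIdx L j i)) b, C * Real.exp (-(δ * tdistT (kingVol L (coverIdx j i)) b' b'')) * θ ^ j.K
      = C * (∑ b'' ∈ fiber (proj (kingVol_dvd_coverIdx L j i)) b, Real.exp (-(δ * tdistT (kingVol L (coverIdx j i)) b' b''))) * θ ^ j.K := by
        rw [Finset.mul_sum, Finset.sum_mul]
    _ ≤ C * (latticeConst (d + 1) (δ / 2) * Real.exp (-(δ / 2 * tdistT (kingVol L j) (proj (kingVol_dvd_coverIdx L j i) b') b))) * θ ^ j.K := by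
        gcongr

/-! ## §3 Density: every toron -/

/-- The approximating angles converge along ANY sequence of orders `P_i ≥ i + 1`. [folklore] -/
theorem tendsto_rootAngle_of_le {P : ℕ → ℕ} (hP : ∀ i, i + 1 ≤ P i) (φ : ℝ) : Tendsto (fun i : ℕ => rootAngle (P i) φ) atTop (𝓝 φ) := by
  rw [tendsto_iff_norm_sub_tendsto_zero]
  have hbound : ∀ i : ℕ, ‖rootAngle (P i) φ - φ‖ ≤ 2 * Real.pi * (1 / ((i : ℝ) + 1)) := fun i => by
    rw [Real.norm_eq_abs, mul_one_div]
    have hPi : 0 < P i := by have := hP i; omega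
    refine (abs_rootAngle_sub_le hPi φ).trans ?_
    have hi : (0 : ℝ) < (i : ℝ) + 1 := by positivity
    refine div_le_div_of_nonneg_left (by positivity) hi ?_
    exact_mod_cast hP i
  refine squeeze_zero (fun i => norm_nonneg _) hbound ?_
  have h := tendsto_one_div_add_atTop_nhds_zero_nat (𝕜 := ℝ)
  have : Tendsto (fun n : ℕ => (2 * Real.pi) * (1 / ((n : ℝ) + 1))) atTop (𝓝 ((2 * Real.pi) * 0)) := h.const_mul _
  rw [mul_zero] at this
  exact this

/-- Root-of-unity approximation along any sequence of orders `P_i ≥ i + 1`. [folklore] -/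
theorem tendsto_rootApprox_of_le {P : ℕ → ℕ} (hP : ∀ i, i + 1 ≤ P i) (φ : ℝ) :
    Tendsto (fun i : ℕ => rootApprox (P i) φ) atTop (𝓝 (Complex.exp ((φ : ℂ) * I))) := by
  unfold rootApprox
  exact Filter.Tendsto.cexp (((Complex.continuous_ofReal.tendsto φ).comp (tendsto_rootAngle_of_le hP φ)).mul_const I)

omit [NeZero L] in
/-- `i + 1 ≤ c·L^i` for `c ≥ 1`, `L ≥ 2`. [folklore] -/
theorem succ_le_mul_pow (hL : 2 ≤ L) {c : ℕ} (hc : 1 ≤ c) (i : ℕ) : i + 1 ≤ c * L ^ i := by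
  have h1 : i + 1 ≤ L ^ i := by
    have := Nat.lt_pow_self (n := i) (by omega : 1 < L)
    omega
  calc i + 1 ≤ 1 * L ^ i := by omega
    _ ≤ c * L ^ i := Nat.mul_le_mul_right _ hc

/-- The `i`-th approximant of the finer phase vector with trivial holonomy on the cover `2L^{m+i}`. [folklore] -/
def approxTop (j : KingVolIndex d) (φ : Fin (d + 1) → ℝ) (i : ℕ) : Fin (d + 1) → ℂ := fun μ => rootApprox (fine (L ^ 1 * L ^ j.K) (kingVol L (coverIdx j i)) μ) (φ μ)

/-- Trivial holonomy of the approximant on the cover. [folklore] -/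
theorem approxTop_pow_period (j : KingVolIndex d) (φ : Fin (d + 1) → ℝ) (i : ℕ) (μ : Fin (d + 1)) :
    approxTop L j φ i μ ^ fine (L ^ 1 * L ^ j.K) (kingVol L (coverIdx j i)) μ = 1 := by
  haveI := kingVol_neZero L (coverIdx j i)
  exact rootApprox_pow_eq_one (NeZero.ne _) _

/-- The approximants converge to `e^{iφ}`. [folklore] -/
theorem tendsto_approxTop (hL : 2 ≤ L) (j : KingVolIndex d) (φ : Fin (d + 1) → ℝ) :
    Tendsto (fun i => approxTop L j φ i) atTop (𝓝 (fun μ => Complex.exp ((φ μ : ℂ) * I))) := by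
  rw [tendsto_pi_nhds]
  intro μ
  refine tendsto_rootApprox_of_le (fun i => ?_) (φ μ)
  have hper : fine (L ^ 1 * L ^ j.K) (kingVol L (coverIdx j i)) μ = (L ^ 1 * L ^ j.K * 2 * L ^ j.m) * L ^ i := by
    simp only [fine, kingVol, coverIdx, pow_add]; ring
  rw [hper]
  exact succ_le_mul_pow L hL (Nat.one_le_iff_ne_zero.mpr (by positivity [NeZero.ne L])) i

omit [NeZero L] in
/-- ★ The base-point top-piece kernel is continuous in the phase vector at every unit `ω` (`a_K ≥ 0`, `m² > 0`). [cite: King1986, (4.44) p.675] -/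
theorem continuousAt_topPieceTwBase_apply (N : ℕ) [NeZero N] (M : Fin (d + 1) → ℕ) [∀ μ, NeZero (M μ)] {a m2 : ℝ} (K : ℕ) (ha : 0 ≤ aK a L K) (hm : 0 < m2)
    {ω₀ : Fin (d + 1) → ℂ} (hω₀ : ∀ μ, ‖ω₀ μ‖ = 1) (b b' : Tor M) :
    ContinuousAt (fun ω : Fin (d + 1) → ℂ => topPieceTwBase N M L a m2 K ω b b') ω₀ := by
  simp only [topPieceTwBase_apply, topPieceTw, Matrix.smul_apply, Matrix.sub_apply, smul_eq_mul]
  refine ContinuousAt.mul continuousAt_const (ContinuousAt.sub ?_ ?_)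
  · exact continuousAt_toronOp_inv_apply (fine N M) (sq_nonneg _) hm hω₀ _ _
  · exact ((continuous_id.matrix_elem _ _).continuousAt).comp (continuousAt_fineOpTw_inv N M ha (sq_nonneg _) hm hω₀)

/-- ★ The toron top-piece step is continuous in `ω` at every unit `ω` (`a > 0`, `L ≥ 2`, `m² > 0`). [cite: King1986, (4.45) p.675] -/
theorem continuousAt_toronTopPieceStep (hL : 2 ≤ L) {a : ℝ} (ha : 0 < a) {m2 : ℝ} (hm : 0 < m2) (j : KingVolIndex d) {ω₀ : Fin (d + 1) → ℂ} (hω₀ : ∀ μ, ‖ω₀ μ‖ = 1)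
    (b b' : Tor (kingVol L j)) :
    haveI := kingVol_neZero L j
    ContinuousAt (fun ω : Fin (d + 1) → ℂ => toronTopPieceStep L a m2 j ω b b') ω₀ := by
  haveI := kingVol_neZero L j
  have hL1 : (1 : ℝ) < L := by exact_mod_cast hL
  have hpow : Continuous (fun ω : Fin (d + 1) → ℂ => (fun μ => ω μ ^ (L ^ 1))) := continuous_pi fun μ => (continuous_apply μ).pow _
  have hω₁ : ∀ μ, ‖(fun μ => ω₀ μ ^ (L ^ 1)) μ‖ = 1 := fun μ => by simp [norm_pow, hω₀ μ]
  have h1 : ContinuousAt (fun ω : Fin (d + 1) → ℂ => topPieceTwBase (L ^ 1 * L ^ j.K) (kingVol L j) L a m2 (j.K + 1) ω b b') ω₀ :=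
    continuousAt_topPieceTwBase_apply L _ _ (j.K + 1) (aK_pos ha hL1 (by omega)).le hm hω₀ b b'
  have h2 : ContinuousAt ((fun ω' : Fin (d + 1) → ℂ => topPieceTwBase (L ^ j.K) (kingVol L j) L a m2 j.K ω' b b') ∘ (fun ω : Fin (d + 1) → ℂ => fun μ => ω μ ^ (L ^ 1))) ω₀ :=
    ContinuousAt.comp (continuousAt_topPieceTwBase_apply L (L ^ j.K) (kingVol L j) j.K (aK_pos ha hL1 j.one_le_K).le hm hω₁ b b') hpow.continuousAt
  exact ContinuousAt.sub h1 h2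

/-- ★★★★ **THE TWO-SPACING RATE OF KING's TOP-SCALE PIECE AT EVERY TORON**: for odd `L ≥ 3`, `a, m² > 0`, `0 < γ ≤ 1` there are `C, δ > 0` (functions of `d, L, a, m², γ` only) with
`‖toronTopPieceStep j ω b₀ b‖ ≤ C·e^{−δ·d(b₀,b)}·(L^{−γ∕2})^K` for EVERY index `j` (every volume `2L^m`, every `K ≥ 1`), EVERY unit phase vector `ω` and all base points — «Proposition 3.9 holds for
`G^η_{(K)}`» (King p.675) at every constant abelian link field. [cite: King1986, Prop. 3.9 (3.73) p.665, p.675, (4.45) p.675] -/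
theorem norm_toronTopPieceStep_le_all (hLodd : Odd L) (hL : 2 ≤ L) {a m2 : ℝ} (ha : 0 < a) (hm : 0 < m2) {γ : ℝ} (hγ0 : 0 < γ) (hγ1 : γ ≤ 1) :
    ∃ C δ : ℝ, 0 < C ∧ 0 < δ ∧ ∀ (j : KingVolIndex d) (ω : Fin (d + 1) → ℂ), (∀ μ, ‖ω μ‖ = 1) → ∀ b₀ b : Tor (kingVol L j),
      haveI := kingVol_neZero L j
      ‖toronTopPieceStep L a m2 j ω b₀ b‖ ≤ C * Real.exp (-(δ * tdistT (kingVol L j) b₀ b)) * ((L : ℝ) ^ (-(γ / 2))) ^ j.K := by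
  obtain ⟨C, δ, hC, hδ, H⟩ := topPiece_step_le (d := d) L hLodd hL ha hm hγ0 hγ1
  have hθ : 0 ≤ (L : ℝ) ^ (-(γ / 2)) := Real.rpow_nonneg (Nat.cast_nonneg _) _
  have hK : 0 ≤ latticeConst (d + 1) (δ / 2) := latticeConst_nonneg _ (by positivity)
  refine ⟨C * latticeConst (d + 1) (δ / 2) + 1, δ / 2, by positivity, half_pos hδ, fun j ω hω b₀ b => ?_⟩
  haveI := kingVol_neZero L j
  set φ : Fin (d + 1) → ℝ := fun μ => Complex.arg (ω μ) with hφ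
  have hωφ : (fun μ => Complex.exp ((φ μ : ℂ) * I)) = ω := funext fun μ => exp_arg_mul_I_of_norm_eq_one (hω μ)
  have happrox : Tendsto (fun i => approxTop L j φ i) atTop (𝓝 ω) := by rw [← hωφ]; exact tendsto_approxTop L hL j φ
  have hlim : Tendsto (fun i => ‖toronTopPieceStep L a m2 j (approxTop L j φ i) b₀ b‖) atTop (𝓝 ‖toronTopPieceStep L a m2 j ω b₀ b‖) :=
    ((continuousAt_toronTopPieceStep L hL ha hm j hω b₀ b).tendsto.comp happrox).norm
  have hbound : ∀ i, ‖toronTopPieceStep L a m2 j (approxTop L j φ i) b₀ b‖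
      ≤ C * (latticeConst (d + 1) (δ / 2) * Real.exp (-(δ / 2 * tdistT (kingVol L j) b₀ b))) * ((L : ℝ) ^ (-(γ / 2))) ^ j.K := fun i => by
    haveI := kingVol_neZero L (coverIdx j i)
    have h := norm_toronTopPieceStep_le_closed L hL ha hm hC.le hδ hθ H j i (approxTop_pow_period L j φ i) (lift (kingVol_dvd_coverIdx L j i) b₀) b
    rwa [proj_lift] at h
  have hle := le_of_tendsto' hlim hbound
  refine hle.trans ?_
  have hE := Real.exp_pos (-(δ / 2 * tdistT (kingVol L j) b₀ b))
  calc C * (latticeConst (d + 1) (δ / 2) * Real.exp (-(δ / 2 * tdistT (kingVol L j) b₀ b))) * ((L : ℝ) ^ (-(γ / 2))) ^ j.K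
      = C * latticeConst (d + 1) (δ / 2) * Real.exp (-(δ / 2 * tdistT (kingVol L j) b₀ b)) * ((L : ℝ) ^ (-(γ / 2))) ^ j.K := by ring
    _ ≤ (C * latticeConst (d + 1) (δ / 2) + 1) * Real.exp (-(δ / 2 * tdistT (kingVol L j) b₀ b)) * ((L : ℝ) ^ (-(γ / 2))) ^ j.K := by
        gcongr; linarith

end Summit.QuantumFields.YangMills.BalabanUVNodes.N15KingModelRung.Cover

end
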